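import Summits.CriticalPhenomena.PercolationContinuityZ3.Theorems.Transplant.SkelPhiConcFaceRegion
import Summits.CriticalPhenomena.PercolationContinuityZ3.Theorems.Transplant.TwoAxisParaCellsSkel
import HarnessLib

/-!
# N1 ({±1} node), kit adapter part 1 (hp-8 g31): the window-span STEP DEVICES without `Steps` for the window map — `mem_VWin_of_adj`,
# `root_mem_VWin_of_adj`, **`Win_subset_VWin_of_thicken_of_adj`** for ANY 1-Lipschitz planar map `ψ` whose root has a neighbour, and the
# instances at the COARSE skeleton `Skelφ.coarseSkel` (p266580) with the neighbour supplied by `Steps` of the FINE map `φ` (two maps: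
# regions at `ρ∘φ`, steps at `φ` — NEG-NODE-F-SCOPE §12 (s2)(s3), F-COLUMN-N1-PLAN §1 row `SkelPhiConcFaceRegion`)

builds on p205010 (kernel theorem, internal audit signed; external expert review pending) — nothing in this file uses p205010.
Lane `prim-bschramm`, seat `prim-hp-8` (gen 31); helper file (`--supports stmt-CriticalPhenomena-4575 --as helper`).
The D″ devices `Skelφ.mem_VWin_of_step` / `root_mem_VWin` / `Win_subset_VWin_of_thicken` (SkelPhiWindowSpans §3, SkelPhiConcFaceRegion §1) take
`hstep : Steps G φ` for the SAME map that defines the windows; the coarse skeleton has no unit steps, but the devices only need ONE neighbour of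
the vertex whose footprint stays in the (thickened) planar region — which ψ-Lipschitz gives for every neighbour.
[cite: KozmaNitzan2024, §4 p. 26 (E_{v,x}), p. 31 (D is a subbox of Ω)] [cite: MartineauTassion2017, §4.3]
-/

noncomputable section

open scoped Classical

namespace Summit.CriticalPhenomena.PercolationContinuityZ3.Theorems.Transplant

namespace Skelφ

open Literature.Probability.Percolation Literature.Probability.LatticeModels SimpleGraph KNCells
open Literature.Barriers.CriticalPhenomena (graphBall graphBall_finite mem_graphBall_self graphBall_mono)

variable {V : Type} [DecidableEq V] {G : SimpleGraph V} [G.LocallyFinite] {ψ : V → Site 2}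

/-- **Membership in a span from ANY inside neighbour**: a vertex `y` of depth `≤ n`, `n + 1 ≤ R`, footprint in `P`, with a neighbour `y'` whose
footprint is in `P`, lies in `VWin G ψ w₀ P R`. [this work] -/
theorem mem_VWin_of_adj {w₀ : V} {P : Finset (Site 2)} {R n : ℕ} {y y' : V} (hy : y ∈ graphBall G w₀ n) (hn : n + 1 ≤ R)
    (hP : ψ y ∈ P) (hadj : G.Adj y y') (hP' : ψ y' ∈ P) : y ∈ VWin G ψ w₀ P R := by
  refine (PlanarSkeletonConc.mem_vspan_edgesIn_of_adj ?_ ?_ hadj).1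
  · exact (mem_Win G ψ).2 ⟨graphBall_mono G w₀ (by omega) hy, hP⟩
  · exact (mem_Win G ψ).2 ⟨graphBall_mono G w₀ hn (BoxProdZ2.mem_graphBall_succ_of_adj G hy hadj), hP'⟩

/-- **The root lies in the span of its window** when it has a neighbour whose footprint is in the (depth `≥ 1`) window's region. [folklore] -/
theorem root_mem_VWin_of_adj {w₀ y' : V} {P : Finset (Site 2)} {R : ℕ} (hR : 1 ≤ R) (hP : ψ w₀ ∈ P) (hadj : G.Adj w₀ y')
    (hP' : ψ y' ∈ P) : w₀ ∈ VWin G ψ w₀ P R :=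
  mem_VWin_of_adj (mem_graphBall_self G w₀ 0) (by omega) hP hadj hP'

/-- **A plain window lies in the span of the window over a planar 1-thickening** (depth `≥ 1`) for ANY 1-Lipschitz planar map whose root has a
neighbour — every other vertex has its geodesic predecessor inside (`Lip`), the root its neighbour (`Lip` again).  Generalises
`Skelφ.Win_subset_VWin_of_thicken` (which takes `Steps` of the window map). [this work] -/
theorem Win_subset_VWin_of_thicken_of_adj (hlip : Lip G ψ) {w₀ y₀ : V} (hroot : G.Adj w₀ y₀) {Pl Pl' : Finset (Site 2)}
    (hP : ∀ t ∈ Pl, ∀ t' : Site 2, (∀ i, |t' i - t i| ≤ 1) → t' ∈ Pl') {R : ℕ} (hR : 1 ≤ R) :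
    Win G ψ w₀ Pl R ⊆ VWin G ψ w₀ Pl' R := by
  intro y hy
  obtain ⟨hyB, hyP⟩ := (mem_Win G ψ).1 hy
  have hyP' : ψ y ∈ Pl' := hP _ hyP _ fun i => by simp
  by_cases hne : y = w₀
  · subst hne
    exact root_mem_VWin_of_adj hR hyP' hroot (hP _ hyP _ fun i => by rw [abs_sub_comm]; exact hlip hroot i)
  · obtain ⟨z, hz, hadj⟩ := PlanarSkeletonConc.exists_adj_mem_graphBall_of_ne hyB hne
    have hzP' : ψ z ∈ Pl' := hP _ hyP _ fun i => by rw [abs_sub_comm]; exact hlip hadj.symm i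
    exact (PlanarSkeletonConc.mem_vspan_edgesIn_of_adj ((mem_Win G ψ).2 ⟨hyB, hyP'⟩) ((mem_Win G ψ).2 ⟨hz, hzP'⟩) hadj.symm).1

/-! ## The instances at the coarse skeleton (two maps: windows at `ρ ∘ φ`, the neighbour from `Steps` of `φ`) -/

variable {φ : V → Site 2}

omit [DecidableEq V] [G.LocallyFinite] in
/-- Under (ι) steps of the fine map every vertex has a neighbour. [folklore] -/
theorem exists_adj_of_steps (hstep : Steps G φ) (w : V) : ∃ y, G.Adj w y := by
  obtain ⟨y, hadj, -⟩ := hstep w 0 1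
  exact ⟨y, hadj⟩

/-- **A plain COARSE window lies in the span of the coarse window over a 1-thickening**: windows over `Skelφ.coarseSkel φ t …`, hypotheses
`Lip` + `Steps` of the FINE map `φ` and the ρ-Lipschitz admissibility `c·L_i ≤ D`. [this work] -/
theorem Win_subset_VWin_of_thicken_coarse (hlip : Lip G φ) (hstep : Steps G φ) (t : V) {A n h vα vβ c s₀ s₁ D : ℤ} (hc : 0 ≤ c) (hD : 0 < D)
    (hL0 : c * (|A| * (|vβ| + |vα|)) ≤ D) (hL1 : c * (|A| * (|n| + |h|)) ≤ D) {w₀ : V} {Pl Pl' : Finset (Site 2)}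
    (hP : ∀ s ∈ Pl, ∀ s' : Site 2, (∀ i, |s' i - s i| ≤ 1) → s' ∈ Pl') {R : ℕ} (hR : 1 ≤ R) :
    Win G (coarseSkel φ t A n h vα vβ c s₀ s₁ D) w₀ Pl R ⊆ VWin G (coarseSkel φ t A n h vα vβ c s₀ s₁ D) w₀ Pl' R := by
  obtain ⟨y₀, hy₀⟩ := exists_adj_of_steps hstep w₀
  exact Win_subset_VWin_of_thicken_of_adj (lip_coarseSkel hlip t hc hD hL0 hL1) hy₀ hP hR

/-- **The root lies in the span of its coarse window** (depth `≥ 1`, region containing the 1-thickening of the root's coarse footprint). [folklore] -/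
theorem root_mem_VWin_coarse (hlip : Lip G φ) (hstep : Steps G φ) (t : V) {A n h vα vβ c s₀ s₁ D : ℤ} (hc : 0 ≤ c) (hD : 0 < D)
    (hL0 : c * (|A| * (|vβ| + |vα|)) ≤ D) (hL1 : c * (|A| * (|n| + |h|)) ≤ D) {w₀ : V} {P : Finset (Site 2)} {R : ℕ} (hR : 1 ≤ R)
    (hP : ∀ s' : Site 2, (∀ i, |s' i - coarseSkel φ t A n h vα vβ c s₀ s₁ D w₀ i| ≤ 1) → s' ∈ P) :
    w₀ ∈ VWin G (coarseSkel φ t A n h vα vβ c s₀ s₁ D) w₀ P R := by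
  obtain ⟨y₀, hy₀⟩ := exists_adj_of_steps hstep w₀
  have hlipρ := lip_coarseSkel hlip t hc hD hL0 hL1 (A := A) (n := n) (h := h) (vα := vα) (vβ := vβ) (c := c) (s₀ := s₀) (s₁ := s₁) (D := D)
  refine root_mem_VWin_of_adj hR (hP _ fun i => by simp) hy₀ (hP _ fun i => ?_)
  rw [abs_sub_comm]; exact hlipρ hy₀ i

end Skelφ

end Summit.CriticalPhenomena.PercolationContinuityZ3.Theorems.Transplant

end
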